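import Summits.Ventures.PercRepro.ProfilePointedCircuitClassesStarSharpD0Y

/-!
# PercRepro — CASE D0 OF `StarNineSharp`, PART Z: THE `ef`-PLANE BOUND FOR A THREE-POINT TRACE
(p5, gen 55; `proofs/P5-GM1.md` §82 (d))

`hHcls_of_trace_three` — the hypothesis `hHcls` of `inCount_thru_le_of_no_on_line_e_of_H_bound` (D0R) for a
`b`-generic `b` and a trace `T = H ∩ X` of three points: the `ef`-plane demands are at most the bi-bases `{e, f} + σ`
whose pair is not an ON demand plus the ON sets `{e, f, t} + b`.  The demands are indexed by their opposite vertices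
(`oppVertex`), every demand owns a target (part W), three demands make every trace point a C-point (part X), the
count is part Y, and the targets inject into the two target kinds (part U).
-/

open scoped Matroid

namespace PercRepro.Cogirth

open Finset ThmH Skew Shadow Profile

open Classical

variable {α : Type} [DecidableEq α] {N : Matroid α} [N.Finite]

section StarSharpD0Z

variable {b b' : α}

/-- The opposite vertex of an `ef`-plane demand `W = {b, e} ∪ π` in the trace `{x, y, z}`
(`z` for `π = {x, y}`, `y` for `π = {x, z}`, `x` otherwise). -/
def oppVertex (b e x y z : α) (W : Finset α) : α :=
  if (W.erase b).erase e = {x, y} then z else if (W.erase b).erase e = {x, z} then y else x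

/-- `oppVertex` on the pair `{x, y}`. -/
theorem oppVertex_xy {e x y z : α} {W : Finset α} (hW : (W.erase b).erase e = {x, y}) :
    oppVertex b e x y z W = z := by
  unfold oppVertex; rw [if_pos hW]

/-- `oppVertex` on the pair `{x, z}`. -/
theorem oppVertex_xz {e x y z : α} (hyz : y ≠ z) {W : Finset α} (hW : (W.erase b).erase e = {x, z}) :
    oppVertex b e x y z W = y := by
  unfold oppVertex
  rw [if_neg, if_pos hW]
  intro h'
  rw [hW] at h'
  have hy : y ∈ ({x, z} : Finset α) := by rw [h']; exact mem_insert_of_mem (mem_singleton_self _)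
  have hz : z ∈ ({x, y} : Finset α) := by rw [← h']; exact mem_insert_of_mem (mem_singleton_self _)
  simp only [mem_insert, mem_singleton] at hy hz
  rcases hy with rfl | rfl
  · rcases hz with h1 | h1 <;> exact hyz h1.symm
  · exact hyz rfl

/-- `oppVertex` on the pair `{y, z}`. -/
theorem oppVertex_yz {e x y z : α} (hxy : x ≠ y) (hxz : x ≠ z) {W : Finset α} (hW : (W.erase b).erase e = {y, z}) :
    oppVertex b e x y z W = x := by
  unfold oppVertex
  have hx : x ∉ ({y, z} : Finset α) := by
    simp only [mem_insert, mem_singleton, not_or]; exact ⟨hxy, hxz⟩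
  rw [if_neg, if_neg]
  · intro h'
    rw [hW] at h'
    exact hx (by rw [h']; exact mem_insert_self _ _)
  · intro h'
    rw [hW] at h'
    exact hx (by rw [h']; exact mem_insert_self _ _)

/-- **THE `ef`-PLANE BOUND FOR A THREE-POINT TRACE** (`b`-generic): the `ef`-plane demands are at most the bi-bases
`{e, f} + σ` whose pair is not an ON demand plus the ON sets `{e, f, t} + b` — the hypothesis `hHcls` of
`inCount_thru_le_of_no_on_line_e_of_H_bound`. -/
theorem hHcls_of_trace_three (hn : (gr N).card = 9) (hR : rk N (gr N) = 5) (h : SeriesPair N b b')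
    {e f : α} (he : e ∈ gr N) (hf : f ∈ gr N) (hef : e ≠ f) (heb : e ≠ b) (heb' : e ≠ b') (hfb : f ≠ b) (hfb' : f ≠ b')
    (hE7 : rk N (((gr N).erase b).erase b') = 4)
    (hnle : ∀ S : Finset α, S ⊆ ((gr N).erase b).erase b' → e ∈ S → rk N (insert b (insert b' S)) ≤ 3 → rk N S ≤ 1)
    (he1 : ∀ y ∈ ((((gr N).erase b).erase b').erase f).erase e, rk N {e, y} = 2)
    (hf1 : ∀ y ∈ ((((gr N).erase b).erase b').erase f).erase e, rk N {f, y} = 2)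
    (hX : rk N (((((gr N).erase b).erase b').erase f).erase e) = 4) (hef2 : rk N {e, f} = 2)
    (hbg : ∀ y ∈ ((((gr N).erase b).erase b').erase f).erase e, rk N {y, b, b'} = 3)
    {H : Finset α} (hH : H ⊆ ((gr N).erase b).erase b') (heH : e ∈ H) (hfH : f ∈ H) (hH3 : rk N H = 3)
    (hHon : rk N (insert b (insert b' H)) = 4)
    (hHfl : ∀ z ∈ ((gr N).erase b).erase b', z ∉ H → rk N (insert z H) = 4)
    (hT3 : ((H.erase e).erase f).card = 3) :
    ((d0DON N b' e f).filter (fun W => ¬ d0c0 N b b' e f W ∧ ¬ d0c1 N b e f W)).card ≤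
      ((biIndepSets N 4).filter (fun B => ((f ∈ B ∧ b' ∉ B) ∧ (e ∈ B ∧ b ∉ B)) ∧
        ¬ (insert b (B.erase f) ∈ biIndepSets N 4 ∧ rk N (insert b (insert b' (B.erase f))) = 4))).card +
      ((biIndepSets N 4).filter (fun W => (f ∈ W ∧ b' ∉ W) ∧
        (e ∈ W ∧ b ∈ W ∧ ¬ (gr N \ W).erase b' ∈ biIndepSets N 4))).card := by
  have hb : b ∈ gr N := h.1
  have hb' : b' ∈ gr N := h.2.1
  have hbb' : b ≠ b' := h.2.2.1
  have hXE : ((((gr N).erase b).erase b').erase f).erase e ⊆ ((gr N).erase b).erase b' :=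
    (erase_subset _ _).trans (erase_subset _ _)
  have heE : e ∈ ((gr N).erase b).erase b' := mem_erase.2 ⟨heb', mem_erase.2 ⟨heb, he⟩⟩
  have hfE : f ∈ ((gr N).erase b).erase b' := mem_erase.2 ⟨hfb', mem_erase.2 ⟨hfb, hf⟩⟩
  have heX : e ∉ ((((gr N).erase b).erase b').erase f).erase e := fun h' => (mem_erase.1 h').1 rfl
  have hfX : f ∉ ((((gr N).erase b).erase b').erase f).erase e := fun h' => (mem_erase.1 (mem_erase.1 h').2).1 rfl
  have hTX : (H.erase e).erase f ⊆ ((((gr N).erase b).erase b').erase f).erase e := by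
    intro t ht
    have htf : t ≠ f := (mem_erase.1 ht).1
    have hte : t ≠ e := (mem_erase.1 (mem_erase.1 ht).2).1
    have htH : t ∈ H := mem_of_mem_erase (mem_of_mem_erase ht)
    exact mem_erase.2 ⟨hte, mem_erase.2 ⟨htf, hH htH⟩⟩
  -- `|X| = 5`, `X ∩ H = T`, `|X ∖ H| = 2`
  have hX5 : (((((gr N).erase b).erase b').erase f).erase e).card = 5 := by
    rw [card_erase_of_mem (mem_erase.2 ⟨hef, heE⟩), card_erase_of_mem hfE,
      card_erase_of_mem (mem_erase.2 ⟨hbb'.symm, hb'⟩), card_erase_of_mem hb, hn]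
  have hXH : ((((gr N).erase b).erase b').erase f).erase e ∩ H = (H.erase e).erase f := by
    ext a
    constructor
    · intro ha
      have h1 := mem_inter.1 ha
      exact mem_erase.2 ⟨(mem_erase.1 (mem_erase.1 h1.1).2).1, mem_erase.2 ⟨(mem_erase.1 h1.1).1, h1.2⟩⟩
    · intro ha
      exact mem_inter.2 ⟨hTX ha, mem_of_mem_erase (mem_of_mem_erase ha)⟩
  have hW2 : (((((gr N).erase b).erase b').erase f).erase e \ H).card = 2 := by
    have := card_sdiff_add_card_inter (((((gr N).erase b).erase b').erase f).erase e) H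
    rw [hXH, hT3, hX5] at this
    omega
  obtain ⟨x, y, z, hxy, hxz, hyz, hTeq⟩ := card_eq_three.1 hT3
  obtain ⟨w, w', hww, hWeq⟩ := card_eq_two.1 hW2
  have hxT : x ∈ (H.erase e).erase f := by rw [hTeq]; exact mem_insert_self _ _
  have hyT : y ∈ (H.erase e).erase f := by rw [hTeq]; exact mem_insert_of_mem (mem_insert_self _ _)
  have hzT : z ∈ (H.erase e).erase f := by
    rw [hTeq]; exact mem_insert_of_mem (mem_insert_of_mem (mem_singleton_self _))
  have hxH : x ∈ H := mem_of_mem_erase (mem_of_mem_erase hxT)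
  have hyH : y ∈ H := mem_of_mem_erase (mem_of_mem_erase hyT)
  have hzH : z ∈ H := mem_of_mem_erase (mem_of_mem_erase hzT)
  have hx := hTX hxT
  have hy := hTX hyT
  have hz := hTX hzT
  have hwW : w ∈ ((((gr N).erase b).erase b').erase f).erase e \ H := by rw [hWeq]; exact mem_insert_self _ _
  have hw'W : w' ∈ ((((gr N).erase b).erase b').erase f).erase e \ H := by
    rw [hWeq]; exact mem_insert_of_mem (mem_singleton_self _)
  have hw : w ∈ ((((gr N).erase b).erase b').erase f).erase e := (mem_sdiff.1 hwW).1
  have hwH : w ∉ H := (mem_sdiff.1 hwW).2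
  have hw' : w' ∈ ((((gr N).erase b).erase b').erase f).erase e := (mem_sdiff.1 hw'W).1
  have hw'H : w' ∉ H := (mem_sdiff.1 hw'W).2
  have hxw : x ≠ w := fun h' => hwH (h' ▸ hxH)
  have hxw' : x ≠ w' := fun h' => hw'H (h' ▸ hxH)
  have hyw : y ≠ w := fun h' => hwH (h' ▸ hyH)
  have hyw' : y ≠ w' := fun h' => hw'H (h' ▸ hyH)
  have hzw : z ≠ w := fun h' => hwH (h' ▸ hzH)
  have hzw' : z ≠ w' := fun h' => hw'H (h' ▸ hzH)
  have hXeq : ((((gr N).erase b).erase b').erase f).erase e = {x, y, z, w, w'} := by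
    ext a
    constructor
    · intro ha
      by_cases haH : a ∈ H
      · have h1 : a ∈ ((((gr N).erase b).erase b').erase f).erase e ∩ H := mem_inter.2 ⟨ha, haH⟩
        rw [hXH, hTeq] at h1
        simp only [mem_insert, mem_singleton] at h1
        rcases h1 with rfl | rfl | rfl
        · exact mem_insert_self _ _
        · exact mem_insert_of_mem (mem_insert_self _ _)
        · exact mem_insert_of_mem (mem_insert_of_mem (mem_insert_self _ _))
      · have h1 : a ∈ ((((gr N).erase b).erase b').erase f).erase e \ H := mem_sdiff.2 ⟨ha, haH⟩
        rw [hWeq] at h1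
        simp only [mem_insert, mem_singleton] at h1
        rcases h1 with rfl | rfl
        · exact mem_insert_of_mem (mem_insert_of_mem (mem_insert_of_mem (mem_insert_self _ _)))
        · exact mem_insert_of_mem (mem_insert_of_mem (mem_insert_of_mem (mem_insert_of_mem (mem_singleton_self _))))
    · intro ha
      simp only [mem_insert, mem_singleton] at ha
      rcases ha with rfl | rfl | rfl | rfl | rfl <;> assumption
  -- the data of an `ef`-plane demand
  have hdata := d0_demand_data h hn hf hef heb hfb hfb' (e := e)
  have hcls := d0_demand_class' h hR hE7 he hf heb heb' hfb hfb' hnle hef2 hH heH hfH hHon hHfl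
  have hfacts : ∀ W ∈ (d0DON N b' e f).filter (fun W => ¬ d0c0 N b b' e f W ∧ ¬ d0c1 N b e f W),
      (W.erase b).erase e ⊆ {x, y, z} ∧ ((W.erase b).erase e).card = 2 ∧
      insert b (insert e ((W.erase b).erase e)) = W ∧
      rk N (insert e ((W.erase b).erase e)) = 3 ∧
      rk N (insert f (((((gr N).erase b).erase b').erase f).erase e \ (W.erase b).erase e)) = 4 ∧
      ¬ (rk N (insert f ((W.erase b).erase e)) = 3 ∧
        rk N (insert e (((((gr N).erase b).erase b').erase f).erase e \ (W.erase b).erase e)) = 4) := by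
    intro W hW
    simp only [d0DON, mem_filter] at hW
    obtain ⟨⟨hWs, hPD, hcW⟩, hnc₀, hnc₁⟩ := hW
    obtain ⟨-, hπX, hπ2, hYeq, hWeq', hYr, hYc, hYon⟩ := hdata W hWs hPD hcW
    obtain ⟨-, hπH⟩ := hcls _ hπX hYr hYon hnc₁
    refine ⟨?_, hπ2, by rw [hYeq, hWeq'], hYr, hYc, ?_⟩
    · rw [← hTeq]
      intro a ha
      exact mem_erase.2 ⟨fun h' => hfX (h' ▸ hπX ha), mem_erase.2 ⟨fun h' => heX (h' ▸ hπX ha),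
        hπH (mem_insert_of_mem ha)⟩⟩
    · rintro ⟨h1, h2⟩
      apply hnc₀
      refine ⟨h1, h2, ?_⟩
      apply rk_insert_bb'_eq_of_subset_H (H := H) _ h1 hH3 hHon
      exact insert_subset hfH ((subset_insert _ _).trans hπH)
  -- the three possible pairs, with their facts in the `{p, q, r}` labelling
  have hget : ∀ W ∈ (d0DON N b' e f).filter (fun W => ¬ d0c0 N b b' e f W ∧ ¬ d0c1 N b e f W),
      ∀ p q r : α, (W.erase b).erase e = {p, q} →
      ((((gr N).erase b).erase b').erase f).erase e \ {p, q} = {r, w, w'} →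
      rk N (insert e {p, q}) = 3 ∧ rk N (insert f {r, w, w'}) = 4 ∧
        ¬ (rk N (insert f {p, q}) = 3 ∧ rk N (insert e {r, w, w'}) = 4) := by
    intro W hW p q r hπ hsd
    obtain ⟨-, -, -, h1, h2, h3⟩ := hfacts W hW
    rw [hπ] at h1 h2 h3
    rw [hsd] at h2 h3
    exact ⟨h1, h2, h3⟩
  -- H1 for a demand pair `{p, q}` with opposite vertex `r`, in the labelling `X = {p, q, r, w, w'}`
  have hH1core : ∀ p q r : α, p ∈ (H.erase e).erase f → q ∈ (H.erase e).erase f → r ∈ (H.erase e).erase f →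
      p ≠ q → p ≠ r → q ≠ r → ((((gr N).erase b).erase b').erase f).erase e = {p, q, r, w, w'} →
      rk N (insert e {p, q}) = 3 → rk N (insert f {r, w, w'}) = 4 →
      ¬ (rk N (insert f {p, q}) = 3 ∧ rk N (insert e {r, w, w'}) = 4) →
      r ∈ ((H.erase e).erase f).filter (fun t => rk N {e, f, t} = 3 ∧
          rk N ((((((gr N).erase b).erase b').erase f).erase e).erase t) = 4) ∨
      (∃ u, (r, u) ∈ (((H.erase e).erase f) ×ˢ (((((gr N).erase b).erase b').erase f).erase e \ H)).filter
          (fun pr => rk N {e, f, pr.1} = 3 ∧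
            rk N (insert b (insert b' (((((gr N).erase b).erase b').erase f).erase e \ {pr.1, pr.2}))) = 5)) ∨
      (∃ x₀ ∈ (H.erase e).erase f, ∀ u ∈ ((((gr N).erase b).erase b').erase f).erase e \ H,
        (x₀, u) ∈ (((H.erase e).erase f) ×ˢ (((((gr N).erase b).erase b').erase f).erase e \ H)).filter
          (fun pr => rk N {e, f, pr.1} = 3 ∧
            rk N (insert b (insert b' (((((gr N).erase b).erase b').erase f).erase e \ {pr.1, pr.2}))) = 5)) := by
    intro p q r hpT hqT hrT hpq hpr hqr hXeq' hY hYc hR0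
    have hpH : p ∈ H := mem_of_mem_erase (mem_of_mem_erase hpT)
    have hqH : q ∈ H := mem_of_mem_erase (mem_of_mem_erase hqT)
    have hrH : r ∈ H := mem_of_mem_erase (mem_of_mem_erase hrT)
    have hp := hTX hpT
    have hq := hTX hqT
    have hr := hTX hrT
    have hpw : p ≠ w := fun h' => hwH (h' ▸ hpH)
    have hpw' : p ≠ w' := fun h' => hw'H (h' ▸ hpH)
    have hqw : q ≠ w := fun h' => hwH (h' ▸ hqH)
    have hqw' : q ≠ w' := fun h' => hw'H (h' ▸ hqH)
    have hrw : r ≠ w := fun h' => hwH (h' ▸ hrH)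
    have hrw' : r ≠ w' := fun h' => hw'H (h' ▸ hrH)
    have key := efplane_demand_target h hR hE7 he hf hef heb heb' hfb hfb' he1 hf1 hX hef2 hbg hH hH3 hHon hHfl
      hpq hpr hqr hww hp hq hr hw hw' hpH hqH hrH hwH hw'H hXeq' hY hYc hR0
    have hXr : (((((gr N).erase b).erase b').erase f).erase e).erase r = {p, q, w, w'} := by
      rw [hXeq']; exact quint_erase_z hpr hqr hrw hrw'
    have hXrw : ((((gr N).erase b).erase b').erase f).erase e \ {r, w} = {p, q, w'} := by
      rw [hXeq']; exact quint_sdiff_zw hpr hpw hqr hqw hrw' hww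
    have hXrw' : ((((gr N).erase b).erase b').erase f).erase e \ {r, w'} = {p, q, w} := by
      rw [hXeq', quint_swap45]; exact quint_sdiff_zw hpr hpw' hqr hqw' hrw hww.symm
    have hXpw : ((((gr N).erase b).erase b').erase f).erase e \ {p, w} = {q, r, w'} := by
      rw [hXeq', quint_rot]; exact quint_sdiff_zw hpq.symm hqw hpr.symm hrw hpw' hww
    have hXpw' : ((((gr N).erase b).erase b').erase f).erase e \ {p, w'} = {q, r, w} := by
      rw [hXeq', quint_rot, quint_swap45]; exact quint_sdiff_zw hpq.symm hqw' hpr.symm hrw' hpw hww.symm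
    have hXqw : ((((gr N).erase b).erase b').erase f).erase e \ {q, w} = {p, r, w'} := by
      rw [hXeq', quint_swap23]; exact quint_sdiff_zw hpq hpw hqr.symm hrw hqw' hww
    have hXqw' : ((((gr N).erase b).erase b').erase f).erase e \ {q, w'} = {p, r, w} := by
      rw [hXeq', quint_swap23, quint_swap45]; exact quint_sdiff_zw hpq hpw' hqr.symm hrw' hqw hww.symm
    rcases key with ⟨hefr, hXr4⟩ | ⟨hefr, hoff | hoff⟩ | ⟨hefp, h1, h2⟩ | ⟨hefq, h1, h2⟩
    · left
      exact mem_filter.2 ⟨hrT, hefr, by rw [hXr]; exact hXr4⟩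
    · right; left
      exact ⟨w, mem_filter.2 ⟨mem_product.2 ⟨hrT, hwW⟩, hefr, by rw [hXrw]; exact hoff⟩⟩
    · right; left
      exact ⟨w', mem_filter.2 ⟨mem_product.2 ⟨hrT, hw'W⟩, hefr, by rw [hXrw']; exact hoff⟩⟩
    · right; right
      refine ⟨p, hpT, ?_⟩
      intro u hu
      rw [hWeq] at hu
      simp only [mem_insert, mem_singleton] at hu
      rcases hu with rfl | rfl
      · exact mem_filter.2 ⟨mem_product.2 ⟨hpT, hwW⟩, hefp, by rw [hXpw]; exact h2⟩
      · exact mem_filter.2 ⟨mem_product.2 ⟨hpT, hw'W⟩, hefp, by rw [hXpw']; exact h1⟩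
    · right; right
      refine ⟨q, hqT, ?_⟩
      intro u hu
      rw [hWeq] at hu
      simp only [mem_insert, mem_singleton] at hu
      rcases hu with rfl | rfl
      · exact mem_filter.2 ⟨mem_product.2 ⟨hqT, hwW⟩, hefq, by rw [hXqw]; exact h2⟩
      · exact mem_filter.2 ⟨mem_product.2 ⟨hqT, hw'W⟩, hefq, by rw [hXqw']; exact h1⟩
  -- the opposite vertices of the demands
  have hopp : ∀ W ∈ (d0DON N b' e f).filter (fun W => ¬ d0c0 N b b' e f W ∧ ¬ d0c1 N b e f W),
      ((W.erase b).erase e = {x, y} ∧ oppVertex b e x y z W = z) ∨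
      ((W.erase b).erase e = {x, z} ∧ oppVertex b e x y z W = y) ∨
      ((W.erase b).erase e = {y, z} ∧ oppVertex b e x y z W = x) := by
    intro W hW
    obtain ⟨hπT, hπ2, -, -, -, -⟩ := hfacts W hW
    rcases pair_of_subset_triple hπT hπ2 with h1 | h1 | h1
    · exact Or.inl ⟨h1, oppVertex_xy h1⟩
    · exact Or.inr (Or.inl ⟨h1, oppVertex_xz hyz h1⟩)
    · exact Or.inr (Or.inr ⟨h1, oppVertex_yz hxy hxz h1⟩)
  have hinj : Set.InjOn (oppVertex b e x y z)
      (((d0DON N b' e f).filter (fun W => ¬ d0c0 N b b' e f W ∧ ¬ d0c1 N b e f W) : Finset (Finset α)) :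
        Set (Finset α)) := by
    intro W₁ hW₁ W₂ hW₂ heq
    rw [mem_coe] at hW₁ hW₂
    obtain ⟨-, -, hW₁eq, -, -, -⟩ := hfacts W₁ hW₁
    obtain ⟨-, -, hW₂eq, -, -, -⟩ := hfacts W₂ hW₂
    rw [← hW₁eq, ← hW₂eq]
    rcases hopp W₁ hW₁ with ⟨h1, h1'⟩ | ⟨h1, h1'⟩ | ⟨h1, h1'⟩ <;>
      rcases hopp W₂ hW₂ with ⟨h2, h2'⟩ | ⟨h2, h2'⟩ | ⟨h2, h2'⟩ <;>
      rw [h1', h2'] at heq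
    · rw [h1, h2]
    · exact absurd heq hyz.symm
    · exact absurd heq hxz.symm
    · exact absurd heq hyz
    · rw [h1, h2]
    · exact absurd heq hxy.symm
    · exact absurd heq hxz
    · exact absurd heq hxy
    · rw [h1, h2]
  have hcardD : ((d0DON N b' e f).filter (fun W => ¬ d0c0 N b b' e f W ∧ ¬ d0c1 N b e f W)).card =
      (((d0DON N b' e f).filter (fun W => ¬ d0c0 N b b' e f W ∧ ¬ d0c1 N b e f W)).image
        (oppVertex b e x y z)).card := (card_image_of_injOn hinj).symm
  have hDtT : ((d0DON N b' e f).filter (fun W => ¬ d0c0 N b b' e f W ∧ ¬ d0c1 N b e f W)).image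
      (oppVertex b e x y z) ⊆ (H.erase e).erase f := by
    intro t ht
    obtain ⟨W, hW, rfl⟩ := mem_image.1 ht
    rcases hopp W hW with ⟨-, h1⟩ | ⟨-, h1⟩ | ⟨-, h1⟩ <;> rw [h1] <;> assumption
  have hsdxy : ((((gr N).erase b).erase b').erase f).erase e \ {x, y} = {z, w, w'} := by
    rw [hXeq]; exact quint_sdiff_xy hxz hxw hxw' hyz hyw hyw'
  have hsdxz : ((((gr N).erase b).erase b').erase f).erase e \ {x, z} = {y, w, w'} := by
    rw [hXeq, quint_swap23]; exact quint_sdiff_xy hxy hxw hxw' hyz.symm hzw hzw'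
  have hsdyz : ((((gr N).erase b).erase b').erase f).erase e \ {y, z} = {x, w, w'} := by
    rw [hXeq, quint_rot]; exact quint_sdiff_xy hxy.symm hyw hyw' hxz.symm hzw hzw'
  have H1 : ∀ t ∈ ((d0DON N b' e f).filter (fun W => ¬ d0c0 N b b' e f W ∧ ¬ d0c1 N b e f W)).image
      (oppVertex b e x y z),
      t ∈ ((H.erase e).erase f).filter (fun t => rk N {e, f, t} = 3 ∧
          rk N ((((((gr N).erase b).erase b').erase f).erase e).erase t) = 4) ∨
      (∃ u, (t, u) ∈ (((H.erase e).erase f) ×ˢ (((((gr N).erase b).erase b').erase f).erase e \ H)).filter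
          (fun pr => rk N {e, f, pr.1} = 3 ∧
            rk N (insert b (insert b' (((((gr N).erase b).erase b').erase f).erase e \ {pr.1, pr.2}))) = 5)) ∨
      (∃ x₀ ∈ (H.erase e).erase f, ∀ u ∈ ((((gr N).erase b).erase b').erase f).erase e \ H,
        (x₀, u) ∈ (((H.erase e).erase f) ×ˢ (((((gr N).erase b).erase b').erase f).erase e \ H)).filter
          (fun pr => rk N {e, f, pr.1} = 3 ∧
            rk N (insert b (insert b' (((((gr N).erase b).erase b').erase f).erase e \ {pr.1, pr.2}))) = 5)) := by
    intro t ht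
    obtain ⟨W, hW, rfl⟩ := mem_image.1 ht
    rcases hopp W hW with ⟨h1, h1'⟩ | ⟨h1, h1'⟩ | ⟨h1, h1'⟩
    · rw [h1']
      obtain ⟨hY, hYc, hR0⟩ := hget W hW x y z h1 hsdxy
      exact hH1core x y z hxT hyT hzT hxy hxz hyz hXeq hY hYc hR0
    · rw [h1']
      obtain ⟨hY, hYc, hR0⟩ := hget W hW x z y h1 hsdxz
      exact hH1core x z y hxT hzT hyT hxz hxy hyz.symm (by rw [hXeq, quint_swap23]) hY hYc hR0
    · rw [h1']
      obtain ⟨hY, hYc, hR0⟩ := hget W hW y z x h1 hsdyz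
      exact hH1core y z x hyT hzT hxT hyz hxy.symm hxz.symm (by rw [hXeq, quint_rot]) hY hYc hR0
  have H2 : (((d0DON N b' e f).filter (fun W => ¬ d0c0 N b b' e f W ∧ ¬ d0c1 N b e f W)).image
      (oppVertex b e x y z)).card = 3 →
      (H.erase e).erase f ⊆ ((H.erase e).erase f).filter (fun t => rk N {e, f, t} = 3 ∧
          rk N ((((((gr N).erase b).erase b').erase f).erase e).erase t) = 4) := by
    intro h3
    have hDt : ((d0DON N b' e f).filter (fun W => ¬ d0c0 N b b' e f W ∧ ¬ d0c1 N b e f W)).image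
        (oppVertex b e x y z) = (H.erase e).erase f := eq_of_subset_of_card_le hDtT (by rw [h3, hT3])
    have hmem : ∀ t ∈ (H.erase e).erase f,
        ∃ W ∈ (d0DON N b' e f).filter (fun W => ¬ d0c0 N b b' e f W ∧ ¬ d0c1 N b e f W),
          oppVertex b e x y z W = t := by
      intro t ht
      rw [← hDt] at ht
      exact mem_image.1 ht
    obtain ⟨Wz, hWz, hWz'⟩ := hmem z hzT
    obtain ⟨Wy, hWy, hWy'⟩ := hmem y hyT
    obtain ⟨Wx, hWx, hWx'⟩ := hmem x hxT
    have hπz : (Wz.erase b).erase e = {x, y} := by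
      rcases hopp Wz hWz with ⟨h1, -⟩ | ⟨-, h1⟩ | ⟨-, h1⟩
      · exact h1
      · rw [h1] at hWz'; exact absurd hWz' hyz
      · rw [h1] at hWz'; exact absurd hWz' hxz
    have hπy : (Wy.erase b).erase e = {x, z} := by
      rcases hopp Wy hWy with ⟨-, h1⟩ | ⟨h1, -⟩ | ⟨-, h1⟩
      · rw [h1] at hWy'; exact absurd hWy'.symm hyz
      · exact h1
      · rw [h1] at hWy'; exact absurd hWy' hxy
    have hπx : (Wx.erase b).erase e = {y, z} := by
      rcases hopp Wx hWx with ⟨-, h1⟩ | ⟨-, h1⟩ | ⟨h1, -⟩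
      · rw [h1] at hWx'; exact absurd hWx'.symm hxz
      · rw [h1] at hWx'; exact absurd hWx'.symm hxy
      · exact h1
    obtain ⟨hYxy, hYcxy, hR0xy⟩ := hget Wz hWz x y z hπz hsdxy
    obtain ⟨hYxz, hYcxz, hR0xz⟩ := hget Wy hWy x z y hπy hsdxz
    obtain ⟨hYyz, hYcyz, hR0yz⟩ := hget Wx hWx y z x hπx hsdyz
    intro t ht
    have ht' := ht
    rw [hTeq] at ht'
    simp only [mem_insert, mem_singleton] at ht'
    rcases ht' with rfl | rfl | rfl
    · obtain ⟨hefx, hXx⟩ := cpoint_of_three_demands he hf hef he1 hf1 hef2 hH heH hH3 hHfl hy hz hx hw hw'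
        hyH hzH hxH hwH hYyz hYcyz hR0yz (by rw [pair_comm' y t]; exact hYxy) (by rw [pair_comm' y t]; exact hR0xy)
        (by rw [pair_comm' z t]; exact hYxz) hYcxz (by rw [pair_comm' z t]; exact hR0xz)
      refine mem_filter.2 ⟨ht, hefx, ?_⟩
      rw [hXeq, quint_rot, quint_erase_z hxy.symm hxz.symm hxw hxw']
      exact hXx
    · obtain ⟨hefy, hXy⟩ := cpoint_of_three_demands he hf hef he1 hf1 hef2 hH heH hH3 hHfl hx hz hy hw hw'
        hxH hzH hyH hwH hYxz hYcxz hR0xz hYxy hR0xy (by rw [pair_comm' z t]; exact hYyz) hYcyz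
        (by rw [pair_comm' z t]; exact hR0yz)
      refine mem_filter.2 ⟨ht, hefy, ?_⟩
      rw [hXeq, quint_swap23, quint_erase_z hxy hyz.symm hyw hyw']
      exact hXy
    · obtain ⟨hefz, hXz⟩ := cpoint_of_three_demands he hf hef he1 hf1 hef2 hH heH hH3 hHfl hx hy hz hw hw'
        hxH hyH hzH hwH hYxy hYcxy hR0xy hYxz hR0xz hYyz hYcyz hR0yz
      refine mem_filter.2 ⟨ht, hefz, ?_⟩
      rw [hXeq, quint_erase_z hxz hyz hzw hzw']
      exact hXz
  have hcount := card_le_cset_add_gset hDtT hT3 hW2 H1 H2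
  have hC := card_cset_le_tcon h hn he hf hef heb heb' hfb hfb' hH heH hfH hH3 hHon
  have hG := card_gset_le_tb4 h hn hR hnle he hf hef heb heb' hfb hfb' he1 hH heH hfH hH3 hHon hHfl
  rw [hcardD]
  omega

end StarSharpD0Z

end PercRepro.Cogirth
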